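import Mathlib
import Literature.MathematicalPhysics.QuantumLattice.WilsonDiracAP
import Summits.QuantumFields.QCD.Theorems.WilsonQuarkChessboardFlatCellOptimalStubBlockReductionAllN
import Summits.QuantumFields.QCD.Theorems.WilsonQuarkChessboardFlatCellOptimalStubBlockCertM4
import Summits.QuantumFields.QCD.Theorems.QuarksAsStableActionCriticalLineDiamagnetismStubBlockClosedForm
import Summits.QuantumFields.QCD.Theorems.QuarksAsStableActionCriticalLineDiamagnetismCheckerEvalSoundB
import Summits.QuantumFields.QCD.Theorems.QuarksAsStableActionCriticalLineDiamagnetismCheckerCert0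
import Summits.QuantumFields.QCD.Theorems.QuarksAsStableActionCriticalLineDiamagnetismCheckerCert1
import Summits.QuantumFields.QCD.Theorems.QuarksAsStableActionCriticalLineDiamagnetismCheckerCert2
import Summits.QuantumFields.QCD.Theorems.QuarksAsStableActionCriticalLineDiamagnetismCheckerCert3
import Summits.QuantumFields.QCD.Theorems.QuarksAsStableActionCriticalLineDiamagnetismStubCornerEntryBound
import Summits.QuantumFields.QCD.Theorems.QuarksAsStableActionCriticalLineDiamagnetismStubBlockMargin3b

/-!
# The certified scalar block margins, `N` colours
(helper for crux stmt-QuantumFields-9307 `FlatCellOptimal`, line `registered`, stub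
`stub_hessianMarginAllN`, sub-goal `stub_blockMarginsAllN` — the `Fin 3 ↦ Fin N` port of the
sibling crux stmt-QuantumFields-9734's `…CriticalLineDiamagnetismStubBlockMargin0/1/2/3a/3b` plus
the `M = 4` margin of gap G2b, wave 7)

What.  On the `2⁴` block `(ℤ/2)⁴` (colour `Fin N`, ANY `N : ℕ`, spin `Fin 4`) with constant central
link phases `u_μ = e^{iθ_μ}·1 ∈ U(N)`, free `r = 1`, `m = 0` Wilson–Dirac operator `B⁰` and hopping
perturbation `Δ(Y)` (both given by their defining equations, as in `…StubBlockReductionAllN`), the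
one-loop block Hessian `Q(Y) = ½ Re tr (B⁰⁻¹ΔY B⁰⁻¹ΔY) − ½ Re tr (B⁰⁻¹Δ(Y⋆Y))` dominates
`γ · 𝒦(Y)`, `𝒦(Y) = Σ_{x,i<j} ‖Y(x,i) + Y(x+î,j) − Y(x+ĵ,i) − Y(x,j)‖²_F`, on tiling-odd
anti-Hermitian link fields `Y : Edge 4 2 → M_N(ℂ)`, with the sibling's certified constants:
* `blockMargin0AllN`  — region 0 (`θ ∈ (0,π)⁴`, no coordinate within `1/2` of `{0,π}`): `γ = 3/2500`;
* `blockMargin1AllN`  — region 1 (exactly one such coordinate): `γ = 13/20000`;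
* `blockMargin2AllN`  — region 2 (exactly two): `γ = −1/4000`;
* `blockMargin3aAllN` — region 3a (at least three, not in the corner box): `γ = −1/1000`;
* `blockMargin3bAllN` — corner box (`min(θ_μ, π − θ_μ) < 1/20` for all `μ`): `γ = −4`;
* `blockMarginM4AllN` — the sixteen `M = 4` twists `θ_μ ∈ {π/8, 3π/8, 5π/8, 7π/8}`: `γ = 1/1000`;
and `stub_blockMarginsAllN` is their conjunction (the registered sub-goal; shared binders prenexed).

How.  Verbatim the sibling's twelve-line assemblies with `Fin 3 ↦ Fin N`: the `N`-colour block
reduction `stub_blockReductionAllN` (`…StubBlockReductionAllN`) reduces `γ 𝒦 ≤ Q` to the per-class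
quadratic-form inequality `64 γ n_s |y|² ≤ yᵀ H(s) y` on `1^⊥`, whose matrix `H(s)` is, entry by
entry on the active axes, the `N`-free real closed form (`stub_blockClosedForm`, definitionally
`Checker.blockHc (cos ∘ θ)`); the inequality for `blockHc` is `Checker.region_sound` applied to the
`native_decide` certificates `Checker.stub_checkerCert0–3` at the point `C = cos ∘ θ`
(`Checker.inRegion_cos`, `Checker.inRegion_cos_three`), respectively the `M = 4` certificate
`stub_blockCertM4` (`…StubBlockCertM4`), and on the corner box Gershgorin/Cauchy–Schwarz
(`BlockMargin3b.form_lower`) with the crude entry bound `stub_cornerEntryBound` (`|Hc| ≤ 256`).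
Nothing here depends on `N`: the colour reduction is entirely inside `stub_blockReductionAllN`.

Sources: Montvay–Münster, *Quantum Fields on a Lattice* §4.2 (Wilson fermions, hopping expansion);
the certificates are the sibling line's interval-arithmetic checker (computational lane).
Pure theorem file (no `def`s).
-/

noncomputable section

open scoped BigOperators Classical Matrix ComplexConjugate
open Finset
open Literature.MathematicalPhysics.QuantumLattice Literature.MathematicalPhysics.QuantumFieldTheory
  Literature.Probability.LatticeModels

namespace Summit.QuantumFields.QCD.Cruxes.FlatCellOptimal.BlockMargins

open Summit.QuantumFields.QCD.Cruxes.CriticalLineDiamagnetism.ChessboardCellGain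
open Summit.QuantumFields.QCD.Cruxes.FlatCellOptimal.BlockReduction (stub_blockReductionAllN)
open Summit.QuantumFields.QCD.Cruxes.FlatCellOptimal.HessianMargin (stub_blockCertM4)

/-- **Region 0** (`γ = 3 / 2500`, `N` colours): block reduction + closed form + the certified computation
of region 0 (`Checker.stub_checkerCert0`). -/
theorem blockMargin0AllN : ∀ (N : ℕ) (θ : Fin 4 → ℝ), (∀ μ, 0 < θ μ ∧ θ μ < Real.pi) → (Finset.univ.filter (fun μ : Fin 4 => min (θ μ) (Real.pi - θ μ) < 1 / 2)).card = 0 → ∀ (u : Fin 4 → Matrix.unitaryGroup (Fin N) ℂ), (∀ μ, ((u μ : Matrix.unitaryGroup (Fin N) ℂ) : Matrix (Fin N) (Fin N) ℂ) = Complex.exp (↑(θ μ) * Complex.I) • (1 : Matrix (Fin N) (Fin N) ℂ)) → ∀ (B0 : Matrix (TorusSite 4 2 × Fin N × Fin 4) (TorusSite 4 2 × Fin N × Fin 4) ℂ) (Dl : (Edge 4 2 → Matrix (Fin N) (Fin N) ℂ) → Matrix (TorusSite 4 2 × Fin N × Fin 4) (TorusSite 4 2 × Fin N × Fin 4) ℂ),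 B0 = wilsonDirac (unitaryFundamentalRep (Fin N) ℂ) (fun e : Edge 4 2 => u e.2) 0 1 → (∀ E, Dl E = Matrix.of fun (p q : TorusSite 4 2 × Fin N × Fin 4) => -(1 / 2 : ℂ) * ∑ μ : Fin 4, ((if q.1 = Site.shift p.1 μ then ((1 : Matrix (Fin 4) (Fin 4) ℂ) - euclideanGamma μ) p.2.2 q.2.2 * (((u μ : Matrix.unitaryGroup (Fin N) ℂ) : Matrix (Fin N) (Fin N) ℂ) * E (p.1, μ)) p.2.1 q.2.1 else 0) + (if p.1 = Site.shift q.1 μ then ((1 : Matrix (Fin 4) (Fin 4) ℂ) + euclideanGamma μ) p.2.2 q.2.2 * (((u μ : Matrix.unitaryGroup (Fin N) ℂ) : Matrix (Fin N) (Fin N) ℂ) * E (q.1, μ))ᴴ p.2.1 q.2.1 else 0))) → ∀ Y : Edge 4 2 → Matrix (Fin N) (Fin N) ℂ, (∀ e, (Y e)ᴴ = -Y e) → (∀ (x : TorusSite 4 2) (μ : Fin 4), Y (Site.shift x μ, μ) = -Y (x, μ)) → (3 / 2500 : ℝ) * (∑ p : Plaquette 4 2, ∑ a, ∑ b, ‖(Y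 (p.1, p.2.1.1) + Y (Site.shift p.1 p.2.1.1, p.2.1.2) - Y (Site.shift p.1 p.2.1.2, p.2.1.1) - Y (p.1, p.2.1.2)) a b‖ ^ 2) ≤ ((B0⁻¹ * Dl Y * (B0⁻¹ * Dl Y)).trace.re / 2 - (B0⁻¹ * Dl (fun e => Y e * Y e)).trace.re / 2) := by
  intro N θ hθ hreg u hu B0 Dl hB0 hDl Y hY hodd
  refine stub_blockReductionAllN N θ u hθ hu B0 Dl _ _ _ _ _ _ _ hB0 hDl (fun _ => rfl) (fun _ => rfl)
    (fun _ => rfl) (fun _ _ _ => rfl) (fun _ _ => rfl) (fun _ _ => rfl) (fun _ _ _ => rfl) (3 / 2500) ?_ Y hY hodd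
  intro s y hsupp hsum
  have hCF := stub_blockClosedForm θ hθ
  have h01 : ∀ a : ZMod 2, a ≠ 1 → a = 0 := by decide
  have hIn := Checker.inRegion_cos (by norm_num) θ hθ hreg
  have hBM := (Checker.region_sound (3 / 2500) 60 0 (by norm_num) Checker.stub_checkerCert0 _ hIn s).le y hsupp hsum
  refine le_of_le_of_eq (le_of_eq_of_le ?_ hBM) ?_
  · unfold Checker.nAct; push_cast; ring
  · refine Finset.sum_congr rfl fun μ _ => Finset.sum_congr rfl fun ν _ => ?_
    by_cases hμ : s μ = 1
    · by_cases hν : s ν = 1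
      · exact congrArg (· * (y μ * y ν)) (hCF s μ ν hμ hν).symm
      · rw [hsupp ν (h01 _ hν)]; ring
    · rw [hsupp μ (h01 _ hμ)]; ring

/-- **Region 1** (`γ = 13 / 20000`, `N` colours): block reduction + closed form + the certified computation
of region 1 (`Checker.stub_checkerCert1`). -/
theorem blockMargin1AllN : ∀ (N : ℕ) (θ : Fin 4 → ℝ), (∀ μ, 0 < θ μ ∧ θ μ < Real.pi) → (Finset.univ.filter (fun μ : Fin 4 => min (θ μ) (Real.pi - θ μ) < 1 / 2)).card = 1 → ∀ (u : Fin 4 → Matrix.unitaryGroup (Fin N) ℂ), (∀ μ, ((u μ : Matrix.unitaryGroup (Fin N) ℂ) : Matrix (Fin N) (Fin N) ℂ) = Complex.exp (↑(θ μ) * Complex.I) • (1 : Matrix (Fin N) (Fin N) ℂ)) → ∀ (B0 : Matrix (TorusSite 4 2 × Fin N × Fin 4) (TorusSite 4 2 × Fin N × Fin 4) ℂ) (Dl : (Edge 4 2 → Matrix (Fin N) (Fin N) ℂ) → Matrix (TorusSite 4 2 × Fin N × Fin 4) (TorusSite 4 2 × Fin N × Fin 4) ℂ), B0 = wilsonDirac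 (unitaryFundamentalRep (Fin N) ℂ) (fun e : Edge 4 2 => u e.2) 0 1 → (∀ E, Dl E = Matrix.of fun (p q : TorusSite 4 2 × Fin N × Fin 4) => -(1 / 2 : ℂ) * ∑ μ : Fin 4, ((if q.1 = Site.shift p.1 μ then ((1 : Matrix (Fin 4) (Fin 4) ℂ) - euclideanGamma μ) p.2.2 q.2.2 * (((u μ : Matrix.unitaryGroup (Fin N) ℂ) : Matrix (Fin N) (Fin N) ℂ) * E (p.1, μ)) p.2.1 q.2.1 else 0) + (if p.1 = Site.shift q.1 μ then ((1 : Matrix (Fin 4) (Fin 4) ℂ) + euclideanGamma μ) p.2.2 q.2.2 * (((u μ : Matrix.unitaryGroup (Fin N) ℂ) : Matrix (Fin N) (Fin N) ℂ) * E (q.1, μ))ᴴ p.2.1 q.2.1 else 0))) → ∀ Y : Edge 4 2 → Matrix (Fin N) (Fin N) ℂ, (∀ e, (Y e)ᴴ = -Y e) → (∀ (x : TorusSite 4 2) (μ : Fin 4), Y (Site.shift x μ, μ) = -Y (x, μ)) → (13 / 20000 : ℝ) * (∑ p : Plaquette 4 2, ∑ a, ∑ b, ‖(Y (p.1, p.2.1.1)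 + Y (Site.shift p.1 p.2.1.1, p.2.1.2) - Y (Site.shift p.1 p.2.1.2, p.2.1.1) - Y (p.1, p.2.1.2)) a b‖ ^ 2) ≤ ((B0⁻¹ * Dl Y * (B0⁻¹ * Dl Y)).trace.re / 2 - (B0⁻¹ * Dl (fun e => Y e * Y e)).trace.re / 2) := by
  intro N θ hθ hreg u hu B0 Dl hB0 hDl Y hY hodd
  refine stub_blockReductionAllN N θ u hθ hu B0 Dl _ _ _ _ _ _ _ hB0 hDl (fun _ => rfl) (fun _ => rfl)
    (fun _ => rfl) (fun _ _ _ => rfl) (fun _ _ => rfl) (fun _ _ => rfl) (fun _ _ _ => rfl) (13 / 20000) ?_ Y hY hodd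
  intro s y hsupp hsum
  have hCF := stub_blockClosedForm θ hθ
  have h01 : ∀ a : ZMod 2, a ≠ 1 → a = 0 := by decide
  have hIn := Checker.inRegion_cos (by norm_num) θ hθ hreg
  have hBM := (Checker.region_sound (13 / 20000) 60 1 (by norm_num) Checker.stub_checkerCert1 _ hIn s).le y hsupp hsum
  refine le_of_le_of_eq (le_of_eq_of_le ?_ hBM) ?_
  · unfold Checker.nAct; push_cast; ring
  · refine Finset.sum_congr rfl fun μ _ => Finset.sum_congr rfl fun ν _ => ?_
    by_cases hμ : s μ = 1
    · by_cases hν : s ν = 1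
      · exact congrArg (· * (y μ * y ν)) (hCF s μ ν hμ hν).symm
      · rw [hsupp ν (h01 _ hν)]; ring
    · rw [hsupp μ (h01 _ hμ)]; ring

/-- **Region 2** (`γ = -(1 / 4000)`, `N` colours): block reduction + closed form + the certified
computation of region 2 (`Checker.stub_checkerCert2`). -/
theorem blockMargin2AllN : ∀ (N : ℕ) (θ : Fin 4 → ℝ), (∀ μ, 0 < θ μ ∧ θ μ < Real.pi) → (Finset.univ.filter (fun μ : Fin 4 => min (θ μ) (Real.pi - θ μ) < 1 / 2)).card = 2 → ∀ (u : Fin 4 → Matrix.unitaryGroup (Fin N) ℂ), (∀ μ, ((u μ : Matrix.unitaryGroup (Fin N) ℂ) : Matrix (Fin N) (Fin N) ℂ) = Complex.exp (↑(θ μ) * Complex.I) • (1 : Matrix (Fin N) (Fin N) ℂ)) → ∀ (B0 : Matrix (TorusSite 4 2 × Fin N × Fin 4) (TorusSite 4 2 × Fin N × Fin 4) ℂ) (Dl : (Edge 4 2 → Matrix (Fin N) (Fin N) ℂ) → Matrix (TorusSite 4 2 × Fin N × Fin 4) (TorusSite 4 2 × Fin N × Fin 4) ℂ), B0 = wilsonDirac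 (unitaryFundamentalRep (Fin N) ℂ) (fun e : Edge 4 2 => u e.2) 0 1 → (∀ E, Dl E = Matrix.of fun (p q : TorusSite 4 2 × Fin N × Fin 4) => -(1 / 2 : ℂ) * ∑ μ : Fin 4, ((if q.1 = Site.shift p.1 μ then ((1 : Matrix (Fin 4) (Fin 4) ℂ) - euclideanGamma μ) p.2.2 q.2.2 * (((u μ : Matrix.unitaryGroup (Fin N) ℂ) : Matrix (Fin N) (Fin N) ℂ) * E (p.1, μ)) p.2.1 q.2.1 else 0) + (if p.1 = Site.shift q.1 μ then ((1 : Matrix (Fin 4) (Fin 4) ℂ) + euclideanGamma μ) p.2.2 q.2.2 * (((u μ : Matrix.unitaryGroup (Fin N) ℂ) : Matrix (Fin N) (Fin N) ℂ) * E (q.1, μ))ᴴ p.2.1 q.2.1 else 0))) → ∀ Y : Edge 4 2 → Matrix (Fin N) (Fin N) ℂ, (∀ e, (Y e)ᴴ = -Y e) → (∀ (x : TorusSite 4 2) (μ : Fin 4), Y (Site.shift x μ, μ) = -Y (x, μ)) → -(1 / 4000 : ℝ) * (∑ p : Plaquette 4 2, ∑ a, ∑ b, ‖(Y (p.1, p.2.1.1)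 + Y (Site.shift p.1 p.2.1.1, p.2.1.2) - Y (Site.shift p.1 p.2.1.2, p.2.1.1) - Y (p.1, p.2.1.2)) a b‖ ^ 2) ≤ ((B0⁻¹ * Dl Y * (B0⁻¹ * Dl Y)).trace.re / 2 - (B0⁻¹ * Dl (fun e => Y e * Y e)).trace.re / 2) := by
  intro N θ hθ hreg u hu B0 Dl hB0 hDl Y hY hodd
  refine stub_blockReductionAllN N θ u hθ hu B0 Dl _ _ _ _ _ _ _ hB0 hDl (fun _ => rfl) (fun _ => rfl)
    (fun _ => rfl) (fun _ _ _ => rfl) (fun _ _ => rfl) (fun _ _ => rfl) (fun _ _ _ => rfl) (-(1 / 4000)) ?_ Y hY hodd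
  intro s y hsupp hsum
  have hCF := stub_blockClosedForm θ hθ
  have h01 : ∀ a : ZMod 2, a ≠ 1 → a = 0 := by decide
  have hIn := Checker.inRegion_cos (by norm_num) θ hθ hreg
  have hBM := (Checker.region_sound (-(1 / 4000)) 60 2 (by norm_num) Checker.stub_checkerCert2 _ hIn s).le y hsupp hsum
  refine le_of_le_of_eq (le_of_eq_of_le ?_ hBM) ?_
  · unfold Checker.nAct; push_cast; ring
  · refine Finset.sum_congr rfl fun μ _ => Finset.sum_congr rfl fun ν _ => ?_
    by_cases hμ : s μ = 1
    · by_cases hν : s ν = 1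
      · exact congrArg (· * (y μ * y ν)) (hCF s μ ν hμ hν).symm
      · rw [hsupp ν (h01 _ hν)]; ring
    · rw [hsupp μ (h01 _ hμ)]; ring

/-- **Region 3a** (`γ = -(1 / 1000)`, `N` colours): block reduction + closed form + the certified
computation of region 3 (`Checker.stub_checkerCert3`). -/
theorem blockMargin3aAllN : ∀ (N : ℕ) (θ : Fin 4 → ℝ), (∀ μ, 0 < θ μ ∧ θ μ < Real.pi) → 3 ≤ (Finset.univ.filter (fun μ : Fin 4 => min (θ μ) (Real.pi - θ μ) < 1 / 2)).card → ¬ (∀ μ : Fin 4, min (θ μ) (Real.pi - θ μ) < 1 / 20) → ∀ (u : Fin 4 → Matrix.unitaryGroup (Fin N) ℂ), (∀ μ, ((u μ : Matrix.unitaryGroup (Fin N) ℂ) : Matrix (Fin N) (Fin N) ℂ) = Complex.exp (↑(θ μ) * Complex.I) • (1 : Matrix (Fin N) (Fin N) ℂ)) → ∀ (B0 : Matrix (TorusSite 4 2 × Fin N × Fin 4) (TorusSite 4 2 × Fin N × Fin 4) ℂ) (Dl : (Edge 4 2 → Matrix (Fin N) (Fin N) ℂ) → Matrix (TorusSite 4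 2 × Fin N × Fin 4) (TorusSite 4 2 × Fin N × Fin 4) ℂ), B0 = wilsonDirac (unitaryFundamentalRep (Fin N) ℂ) (fun e : Edge 4 2 => u e.2) 0 1 → (∀ E, Dl E = Matrix.of fun (p q : TorusSite 4 2 × Fin N × Fin 4) => -(1 / 2 : ℂ) * ∑ μ : Fin 4, ((if q.1 = Site.shift p.1 μ then ((1 : Matrix (Fin 4) (Fin 4) ℂ) - euclideanGamma μ) p.2.2 q.2.2 * (((u μ : Matrix.unitaryGroup (Fin N) ℂ) : Matrix (Fin N) (Fin N) ℂ) * E (p.1, μ)) p.2.1 q.2.1 else 0) + (if p.1 = Site.shift q.1 μ then ((1 : Matrix (Fin 4) (Fin 4) ℂ) + euclideanGamma μ) p.2.2 q.2.2 * (((u μ : Matrix.unitaryGroup (Fin N) ℂ) : Matrix (Fin N) (Fin N) ℂ) * E (q.1, μ))ᴴ p.2.1 q.2.1 else 0))) → ∀ Y : Edge 4 2 → Matrix (Fin N) (Fin N) ℂ, (∀ e, (Y e)ᴴ = -Y e) → (∀ (x : TorusSite 4 2) (μ : Fin 4), Y (Site.shift x μ, μ) = -Y (x, μ)) → -(1 /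 1000 : ℝ) * (∑ p : Plaquette 4 2, ∑ a, ∑ b, ‖(Y (p.1, p.2.1.1) + Y (Site.shift p.1 p.2.1.1, p.2.1.2) - Y (Site.shift p.1 p.2.1.2, p.2.1.1) - Y (p.1, p.2.1.2)) a b‖ ^ 2) ≤ ((B0⁻¹ * Dl Y * (B0⁻¹ * Dl Y)).trace.re / 2 - (B0⁻¹ * Dl (fun e => Y e * Y e)).trace.re / 2) := by
  intro N θ hθ hreg hnc u hu B0 Dl hB0 hDl Y hY hodd
  refine stub_blockReductionAllN N θ u hθ hu B0 Dl _ _ _ _ _ _ _ hB0 hDl (fun _ => rfl) (fun _ => rfl)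
    (fun _ => rfl) (fun _ _ _ => rfl) (fun _ _ => rfl) (fun _ _ => rfl) (fun _ _ _ => rfl) (-(1 / 1000)) ?_ Y hY hodd
  intro s y hsupp hsum
  have hCF := stub_blockClosedForm θ hθ
  have h01 : ∀ a : ZMod 2, a ≠ 1 → a = 0 := by decide
  have hIn := Checker.inRegion_cos_three θ hθ hreg hnc
  have hBM := (Checker.region_sound (-(1 / 1000)) 60 3 (by norm_num) Checker.stub_checkerCert3 _ hIn s).le y hsupp hsum
  refine le_of_le_of_eq (le_of_eq_of_le ?_ hBM) ?_
  · unfold Checker.nAct; push_cast; ring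
  · refine Finset.sum_congr rfl fun μ _ => Finset.sum_congr rfl fun ν _ => ?_
    by_cases hμ : s μ = 1
    · by_cases hν : s ν = 1
      · exact congrArg (· * (y μ * y ν)) (hCF s μ ν hμ hν).symm
      · rw [hsupp ν (h01 _ hν)]; ring
    · rw [hsupp μ (h01 _ hμ)]; ring

/-- **Corner box 3b** (crude claim `γ = -4`, `N` colours): block reduction with `γ = −4`, whose per-class
hypothesis follows from `stub_blockClosedForm` (the entries are the closed form) and `stub_cornerEntryBound`
(`|entry| ≤ 256`) by the sibling's `BlockMargin3b.form_lower` (`64 · (−4) · n = −256 · n`). -/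
theorem blockMargin3bAllN : ∀ (N : ℕ) (θ : Fin 4 → ℝ), (∀ μ, 0 < θ μ ∧ θ μ < Real.pi) → (∀ μ : Fin 4, min (θ μ) (Real.pi - θ μ) < 1 / 20) → ∀ (u : Fin 4 → Matrix.unitaryGroup (Fin N) ℂ), (∀ μ, ((u μ : Matrix.unitaryGroup (Fin N) ℂ) : Matrix (Fin N) (Fin N) ℂ) = Complex.exp (↑(θ μ) * Complex.I) • (1 : Matrix (Fin N) (Fin N) ℂ)) → ∀ (B0 : Matrix (TorusSite 4 2 × Fin N × Fin 4) (TorusSite 4 2 × Fin N × Fin 4) ℂ) (Dl : (Edge 4 2 → Matrix (Fin N) (Fin N) ℂ) → Matrix (TorusSite 4 2 × Fin N × Fin 4) (TorusSite 4 2 × Fin N × Fin 4) ℂ), B0 = wilsonDirac (unitaryFundamentalRep (Fin N) ℂ) (fun e : Edge 4 2 => u e.2) 0 1 → (∀ E, Dl E = Matrix.of fun (p q : TorusSite 4 2 × Fin N × Fin 4) => -(1 / 2 : ℂ) * ∑ μ : Fin 4, ((if q.1 = Site.shift p.1 μ then ((1 : Matrix (Fin 4) (Fin 4) ℂ) - euclideanGamma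 μ) p.2.2 q.2.2 * (((u μ : Matrix.unitaryGroup (Fin N) ℂ) : Matrix (Fin N) (Fin N) ℂ) * E (p.1, μ)) p.2.1 q.2.1 else 0) + (if p.1 = Site.shift q.1 μ then ((1 : Matrix (Fin 4) (Fin 4) ℂ) + euclideanGamma μ) p.2.2 q.2.2 * (((u μ : Matrix.unitaryGroup (Fin N) ℂ) : Matrix (Fin N) (Fin N) ℂ) * E (q.1, μ))ᴴ p.2.1 q.2.1 else 0))) → ∀ Y : Edge 4 2 → Matrix (Fin N) (Fin N) ℂ, (∀ e, (Y e)ᴴ = -Y e) → (∀ (x : TorusSite 4 2) (μ : Fin 4), Y (Site.shift x μ, μ) = -Y (x, μ)) → -(4 : ℝ) * (∑ p : Plaquette 4 2, ∑ a, ∑ b, ‖(Y (p.1, p.2.1.1) + Y (Site.shift p.1 p.2.1.1, p.2.1.2) - Y (Site.shift p.1 p.2.1.2, p.2.1.1) - Y (p.1, p.2.1.2)) a b‖ ^ 2) ≤ ((B0⁻¹ * Dl Y * (B0⁻¹ * Dl Y)).trace.re / 2 - (B0⁻¹ * Dl (fun e => Y e * Y e)).trace.re / 2) := by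
  intro N θ hθ hc u hu B0 Dl hB0 hDl Y hY hodd
  refine stub_blockReductionAllN N θ u hθ hu B0 Dl _ _ _ _ _ _ _ hB0 hDl (fun _ => rfl) (fun _ => rfl)
    (fun _ => rfl) (fun _ _ _ => rfl) (fun _ _ => rfl) (fun _ _ => rfl) (fun _ _ _ => rfl) (-4) ?_ Y hY hodd
  intro s y hsupp hsum
  have hCF := stub_blockClosedForm θ hθ
  have hCB := stub_cornerEntryBound θ hθ hc
  have h01 : ∀ a : ZMod 2, a ≠ 1 → a = 0 := by decide
  have key := BlockMargin3b.form_lower _ (Finset.univ.filter fun μ : Fin 4 => s μ = 1) 256 (by norm_num)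
    (fun μ hμ ν hν => by
      rw [Finset.mem_filter] at hμ hν
      have e := hCF s μ ν hμ.2 hν.2
      have b := hCB s μ ν hμ.2 hν.2
      exact (congrArg (fun t : ℝ => |t|) e).trans_le b)
    y (fun μ hμ => hsupp μ (h01 _ fun h1 => hμ (Finset.mem_filter.2 ⟨Finset.mem_univ _, h1⟩)))
  refine le_of_eq_of_le ?_ key
  ring

/-- **The `M = 4` margin** (`γ = 1 / 1000`, `N` colours): at the sixteen `M = 4` twists
`θ_μ ∈ {π/8, 3π/8, 5π/8, 7π/8}` (all inside `(0,π)`), block reduction + closed form + the `M = 4` certificate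
`stub_blockCertM4` in place of `Checker.region_sound`. -/
theorem blockMarginM4AllN : ∀ (N : ℕ) (θ : Fin 4 → ℝ), (∀ μ : Fin 4, θ μ = Real.pi / 8 ∨ θ μ = 3 * Real.pi / 8 ∨ θ μ = 5 * Real.pi / 8 ∨ θ μ = 7 * Real.pi / 8) → ∀ (u : Fin 4 → Matrix.unitaryGroup (Fin N) ℂ), (∀ μ, ((u μ : Matrix.unitaryGroup (Fin N) ℂ) : Matrix (Fin N) (Fin N) ℂ) = Complex.exp (↑(θ μ) * Complex.I) • (1 : Matrix (Fin N) (Fin N) ℂ)) → ∀ (B0 : Matrix (TorusSite 4 2 × Fin N × Fin 4) (TorusSite 4 2 × Fin N × Fin 4) ℂ) (Dl : (Edge 4 2 → Matrix (Fin N) (Fin N) ℂ) → Matrix (TorusSite 4 2 × Fin N × Fin 4) (TorusSite 4 2 × Fin N × Fin 4) ℂ), B0 = wilsonDirac (unitaryFundamentalRep (Fin N) ℂ) (fun e : Edge 4 2 => u e.2) 0 1 → (∀ E, Dl E = Matrix.of fun (p q : TorusSite 4 2 × Fin N × Fin 4) => -(1 / 2 : ℂ) * ∑ μ : Fin 4,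 ((if q.1 = Site.shift p.1 μ then ((1 : Matrix (Fin 4) (Fin 4) ℂ) - euclideanGamma μ) p.2.2 q.2.2 * (((u μ : Matrix.unitaryGroup (Fin N) ℂ) : Matrix (Fin N) (Fin N) ℂ) * E (p.1, μ)) p.2.1 q.2.1 else 0) + (if p.1 = Site.shift q.1 μ then ((1 : Matrix (Fin 4) (Fin 4) ℂ) + euclideanGamma μ) p.2.2 q.2.2 * (((u μ : Matrix.unitaryGroup (Fin N) ℂ) : Matrix (Fin N) (Fin N) ℂ) * E (q.1, μ))ᴴ p.2.1 q.2.1 else 0))) → ∀ Y : Edge 4 2 → Matrix (Fin N) (Fin N) ℂ, (∀ e, (Y e)ᴴ = -Y e) → (∀ (x : TorusSite 4 2) (μ : Fin 4), Y (Site.shift x μ, μ) = -Y (x, μ)) → (1 / 1000 : ℝ) * (∑ p : Plaquette 4 2, ∑ a, ∑ b, ‖(Y (p.1, p.2.1.1) + Y (Site.shift p.1 p.2.1.1, p.2.1.2) - Y (Site.shift p.1 p.2.1.2, p.2.1.1) - Y (p.1, p.2.1.2)) a b‖ ^ 2) ≤ ((B0⁻¹ * Dl Y * (B0⁻¹ *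 Dl Y)).trace.re / 2 - (B0⁻¹ * Dl (fun e => Y e * Y e)).trace.re / 2) := by
  intro N θ hθ4 u hu B0 Dl hB0 hDl Y hY hodd
  have hθ : ∀ μ, 0 < θ μ ∧ θ μ < Real.pi := fun μ => by
    rcases hθ4 μ with h | h | h | h <;> rw [h] <;> constructor <;> linarith [Real.pi_pos]
  refine stub_blockReductionAllN N θ u hθ hu B0 Dl _ _ _ _ _ _ _ hB0 hDl (fun _ => rfl) (fun _ => rfl)
    (fun _ => rfl) (fun _ _ _ => rfl) (fun _ _ => rfl) (fun _ _ => rfl) (fun _ _ _ => rfl) (1 / 1000) ?_ Y hY hodd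
  intro s y hsupp hsum
  have hCF := stub_blockClosedForm θ hθ
  have h01 : ∀ a : ZMod 2, a ≠ 1 → a = 0 := by decide
  have hBM := (stub_blockCertM4 θ hθ4 s).le y hsupp hsum
  refine le_of_le_of_eq (le_of_eq_of_le ?_ hBM) ?_
  · simp only [Checker.nAct]
  · refine Finset.sum_congr rfl fun μ _ => Finset.sum_congr rfl fun ν _ => ?_
    by_cases hμ : s μ = 1
    · by_cases hν : s ν = 1
      · exact congrArg (· * (y μ * y ν)) (hCF s μ ν hμ hν).symm
      · rw [hsupp ν (h01 _ hν)]; ring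
    · rw [hsupp μ (h01 _ hμ)]; ring

/-- **Sub-goal `stub_blockMarginsAllN` — the six certified scalar block margins for `N` colours**
(regions 0, 1, 2, 3a, the corner box 3b, and the `M = 4` twists): the conjunction of
`blockMargin0AllN`, `blockMargin1AllN`, `blockMargin2AllN`, `blockMargin3aAllN`, `blockMargin3bAllN`,
`blockMarginM4AllN`, with the shared data `N, θ, u, B0, Dl, Y` and their hypotheses prenexed (so that the
registered one-line signature stays under the ledger's 4000-character bound). -/
theorem stub_blockMarginsAllN : ∀ (N : ℕ) (θ : Fin 4 → ℝ) (u : Fin 4 → Matrix.unitaryGroup (Fin N) ℂ), (∀ μ, ((u μ : Matrix.unitaryGroup (Fin N) ℂ) : Matrix (Fin N) (Fin N) ℂ) = Complex.exp (↑(θ μ) * Complex.I) • (1 : Matrix (Fin N) (Fin N) ℂ)) → ∀ (B0 : Matrix (TorusSite 4 2 × Fin N × Fin 4) (TorusSite 4 2 × Fin N × Fin 4) ℂ) (Dl : (Edge 4 2 → Matrix (Fin N) (Fin N) ℂ) → Matrix (TorusSite 4 2 × Fin N × Fin 4) (TorusSite 4 2 × Fin N × Fin 4) ℂ), B0 = wilsonDirac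 (unitaryFundamentalRep (Fin N) ℂ) (fun e : Edge 4 2 => u e.2) 0 1 → (∀ E, Dl E = Matrix.of fun (p q : TorusSite 4 2 × Fin N × Fin 4) => -(1 / 2 : ℂ) * ∑ μ : Fin 4, ((if q.1 = Site.shift p.1 μ then ((1 : Matrix (Fin 4) (Fin 4) ℂ) - euclideanGamma μ) p.2.2 q.2.2 * (((u μ : Matrix.unitaryGroup (Fin N) ℂ) : Matrix (Fin N) (Fin N) ℂ) * E (p.1, μ)) p.2.1 q.2.1 else 0) + (if p.1 = Site.shift q.1 μ then ((1 : Matrix (Fin 4) (Fin 4) ℂ) + euclideanGamma μ) p.2.2 q.2.2 * (((u μ : Matrix.unitaryGroup (Fin N) ℂ) : Matrix (Fin N) (Fin N) ℂ) * E (q.1, μ))ᴴ p.2.1 q.2.1 else 0))) → ∀ Y : Edge 4 2 → Matrix (Fin N) (Fin N) ℂ, (∀ e, (Y e)ᴴ = -Y e) → (∀ (x : TorusSite 4 2) (μ : Fin 4), Y (Site.shift x μ, μ) = -Y (x, μ)) → ((∀ μ, 0 < θ μ ∧ θ μ < Real.pi) → (Finset.univ.filter (fun μ : Fin 4 => min (θ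 μ) (Real.pi - θ μ) < 1 / 2)).card = 0 → (3 / 2500 : ℝ) * (∑ p : Plaquette 4 2, ∑ a, ∑ b, ‖(Y (p.1, p.2.1.1) + Y (Site.shift p.1 p.2.1.1, p.2.1.2) - Y (Site.shift p.1 p.2.1.2, p.2.1.1) - Y (p.1, p.2.1.2)) a b‖ ^ 2) ≤ ((B0⁻¹ * Dl Y * (B0⁻¹ * Dl Y)).trace.re / 2 - (B0⁻¹ * Dl (fun e => Y e * Y e)).trace.re / 2)) ∧ ((∀ μ, 0 < θ μ ∧ θ μ < Real.pi) → (Finset.univ.filter (fun μ : Fin 4 => min (θ μ) (Real.pi - θ μ) < 1 / 2)).card = 1 → (13 / 20000 : ℝ) * (∑ p : Plaquette 4 2, ∑ a, ∑ b, ‖(Y (p.1, p.2.1.1) + Y (Site.shift p.1 p.2.1.1, p.2.1.2) - Y (Site.shift p.1 p.2.1.2, p.2.1.1) - Y (p.1, p.2.1.2)) a b‖ ^ 2) ≤ ((B0⁻¹ * Dl Y * (B0⁻¹ * Dl Y)).trace.re / 2 - (B0⁻¹ * Dl (fun e => Y e * Y e)).trace.re / 2)) ∧ ((∀ μ, 0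 < θ μ ∧ θ μ < Real.pi) → (Finset.univ.filter (fun μ : Fin 4 => min (θ μ) (Real.pi - θ μ) < 1 / 2)).card = 2 → -(1 / 4000 : ℝ) * (∑ p : Plaquette 4 2, ∑ a, ∑ b, ‖(Y (p.1, p.2.1.1) + Y (Site.shift p.1 p.2.1.1, p.2.1.2) - Y (Site.shift p.1 p.2.1.2, p.2.1.1) - Y (p.1, p.2.1.2)) a b‖ ^ 2) ≤ ((B0⁻¹ * Dl Y * (B0⁻¹ * Dl Y)).trace.re / 2 - (B0⁻¹ * Dl (fun e => Y e * Y e)).trace.re / 2)) ∧ ((∀ μ, 0 < θ μ ∧ θ μ < Real.pi) → 3 ≤ (Finset.univ.filter (fun μ : Fin 4 => min (θ μ) (Real.pi - θ μ) < 1 / 2)).card → ¬ (∀ μ : Fin 4, min (θ μ) (Real.pi - θ μ) < 1 / 20) → -(1 / 1000 : ℝ) * (∑ p : Plaquette 4 2, ∑ a, ∑ b, ‖(Y (p.1, p.2.1.1) + Y (Site.shift p.1 p.2.1.1, p.2.1.2) - Y (Site.shift p.1 p.2.1.2, p.2.1.1) - Y (p.1, p.2.1.2)) a b‖ ^ 2)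 ≤ ((B0⁻¹ * Dl Y * (B0⁻¹ * Dl Y)).trace.re / 2 - (B0⁻¹ * Dl (fun e => Y e * Y e)).trace.re / 2)) ∧ ((∀ μ, 0 < θ μ ∧ θ μ < Real.pi) → (∀ μ : Fin 4, min (θ μ) (Real.pi - θ μ) < 1 / 20) → -(4 : ℝ) * (∑ p : Plaquette 4 2, ∑ a, ∑ b, ‖(Y (p.1, p.2.1.1) + Y (Site.shift p.1 p.2.1.1, p.2.1.2) - Y (Site.shift p.1 p.2.1.2, p.2.1.1) - Y (p.1, p.2.1.2)) a b‖ ^ 2) ≤ ((B0⁻¹ * Dl Y * (B0⁻¹ * Dl Y)).trace.re / 2 - (B0⁻¹ * Dl (fun e => Y e * Y e)).trace.re / 2)) ∧ ((∀ μ : Fin 4, θ μ = Real.pi / 8 ∨ θ μ = 3 * Real.pi / 8 ∨ θ μ = 5 * Real.pi / 8 ∨ θ μ = 7 * Real.pi / 8) → (1 / 1000 : ℝ) * (∑ p : Plaquette 4 2, ∑ a, ∑ b, ‖(Y (p.1, p.2.1.1) + Y (Site.shift p.1 p.2.1.1, p.2.1.2) - Y (Site.shift p.1 p.2.1.2, p.2.1.1)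 - Y (p.1, p.2.1.2)) a b‖ ^ 2) ≤ ((B0⁻¹ * Dl Y * (B0⁻¹ * Dl Y)).trace.re / 2 - (B0⁻¹ * Dl (fun e => Y e * Y e)).trace.re / 2)) :=
  fun N θ u hu B0 Dl hB0 hDl Y hY hodd =>
  ⟨fun hθ hreg => blockMargin0AllN N θ hθ hreg u hu B0 Dl hB0 hDl Y hY hodd,
    fun hθ hreg => blockMargin1AllN N θ hθ hreg u hu B0 Dl hB0 hDl Y hY hodd,
    fun hθ hreg => blockMargin2AllN N θ hθ hreg u hu B0 Dl hB0 hDl Y hY hodd,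
    fun hθ hreg hnc => blockMargin3aAllN N θ hθ hreg hnc u hu B0 Dl hB0 hDl Y hY hodd,
    fun hθ hc => blockMargin3bAllN N θ hθ hc u hu B0 Dl hB0 hDl Y hY hodd,
    fun hθ4 => blockMarginM4AllN N θ hθ4 u hu B0 Dl hB0 hDl Y hY hodd⟩

end Summit.QuantumFields.QCD.Cruxes.FlatCellOptimal.BlockMargins

end
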